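import Summits.Ventures.PercRepro.RankLevelSetExplicitLin2KeyL

/-!
# PercRepro — THE LEVEL-17 THEOREM-M ROW OF C-025 OVER THE 5/8 RANGE: THE KEY AT `p = 82 928` (p9, S4; the key is p4's)

`proofs/SUBCLAIM-S4-p9.md` §S4.2⁗⁗. p4's THEOREM-M key `KeyL 17 p d` (RankLevelSetExplicitLin2KeyL) checked by the kernel at
`p = 82 928` on the coranks `18 ≤ d ≤ 81937` of THE 5/8 RANGE (`D' = 17 + 5·2^{14} = 81937`; the large-corank theorem
`c025_core_explicit_large_of58` takes the coranks beyond): `82 928` = the least `p` with the optimal Chernoff pair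
`16·n^n ≤ 2^n·(n − K)^{n−K}·K^K` at `n = p + D'`, `K = 17 + D'` (twin lean-drafts/p9/g7/twin/range58.py), at or above the key's
own floor and the bases `N₁ = 82 187`, `P₂ = 81 973` (RankLevelSetExplicitLin2Bases58); p4's sharp row sits at `132 332`
(RankLevelSetExplicitLin2IndepFloorS). The level step and the unconditional chain are RankLevelSetExplicitLin2IndepFloor58.
Axioms: standard (kernel `decide`).
-/
-- part C: chunks 17 … 24 of 40

namespace PercRepro

namespace ThmN

namespace Explicit

/-- The THEOREM-M key row at `(q, p) = (17, 82 928)`, chunk 17 of 40: coranks `32786 … 34833`, by the kernel. -/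
theorem key_seventeen_indep58_row_17 : ∀ t < 2048, KeyL 17 82928 (18 + (32768 + t)) := by decide +kernel

/-- The THEOREM-M key row at `(q, p) = (17, 82 928)`, chunk 18 of 40: coranks `34834 … 36881`, by the kernel. -/
theorem key_seventeen_indep58_row_18 : ∀ t < 2048, KeyL 17 82928 (18 + (34816 + t)) := by decide +kernel

/-- The THEOREM-M key row at `(q, p) = (17, 82 928)`, chunk 19 of 40: coranks `36882 … 38929`, by the kernel. -/
theorem key_seventeen_indep58_row_19 : ∀ t < 2048, KeyL 17 82928 (18 + (36864 + t)) := by decide +kernel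

/-- The THEOREM-M key row at `(q, p) = (17, 82 928)`, chunk 20 of 40: coranks `38930 … 40977`, by the kernel. -/
theorem key_seventeen_indep58_row_20 : ∀ t < 2048, KeyL 17 82928 (18 + (38912 + t)) := by decide +kernel

/-- The THEOREM-M key row at `(q, p) = (17, 82 928)`, chunk 21 of 40: coranks `40978 … 43025`, by the kernel. -/
theorem key_seventeen_indep58_row_21 : ∀ t < 2048, KeyL 17 82928 (18 + (40960 + t)) := by decide +kernel

/-- The THEOREM-M key row at `(q, p) = (17, 82 928)`, chunk 22 of 40: coranks `43026 … 45073`, by the kernel. -/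
theorem key_seventeen_indep58_row_22 : ∀ t < 2048, KeyL 17 82928 (18 + (43008 + t)) := by decide +kernel

/-- The THEOREM-M key row at `(q, p) = (17, 82 928)`, chunk 23 of 40: coranks `45074 … 47121`, by the kernel. -/
theorem key_seventeen_indep58_row_23 : ∀ t < 2048, KeyL 17 82928 (18 + (45056 + t)) := by decide +kernel

/-- The THEOREM-M key row at `(q, p) = (17, 82 928)`, chunk 24 of 40: coranks `47122 … 49169`, by the kernel. -/
theorem key_seventeen_indep58_row_24 : ∀ t < 2048, KeyL 17 82928 (18 + (47104 + t)) := by decide +kernel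

end Explicit

end ThmN

end PercRepro
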